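import Mathlib
import HarnessLib.Audit.CruxProbe
import HarnessLib
import Summits.CriticalPhenomena.CardyFormulaZ2.Statement
import Summits.CriticalPhenomena.CardyFormulaZ2.Theses.CardySelfDualSegment
import Literature.Probability.Percolation.CornerPercolation
import Summits.CriticalPhenomena.CardyFormulaZ2.Theorems.CardySelfDualSegmentSegmentOpenIffTarget
import Summits.CriticalPhenomena.CardyFormulaZ2.Theorems.CardySelfDualSegmentSegmentOpenSmirnovGermForm
import Summits.CriticalPhenomena.CardyFormulaZ2.Theorems.CardySelfDualSegmentSegmentClosed
import Summits.CriticalPhenomena.CardyFormulaZ2.Theorems.CardySelfDualSegmentSmirnovBasePoint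
import Summits.CriticalPhenomena.CardyFormulaZ2.Theorems.CardySelfDualSegmentQuarterTurnPinning

noncomputable section

namespace Summit.CriticalPhenomena.CardyFormulaZ2.Theses.CardySelfDualSegment

/-- child 1 (r1 split of SegmentOpen) -/
def NearSmirnov : Prop :=
  let prm : unitInterval → Literature.Probability.LatticeModels.Site 2 × Fin 2 → unitInterval := fun t i => if i.2 = 0 then Literature.Probability.Percolation.half else Literature.Probability.Percolation.half * t; let cfg : Set (Literature.Probability.LatticeModels.Site 2 × Fin 2) → Literature.Probability.Percolation.BondConfig (Literature.Probability.LatticeModels.Site 2) := fun S => {e | ∃ v : Literature.Probability.LatticeModels.Site 2, (e = s(v, v + ![1, 0]) ∧ (v, (0 : Fin 2)) ∈ S) ∨ (e = s(v, v + ![0, 1]) ∧ ((v, (0 : Fin 2)) ∈ S ↔ (v, (1 : Fin 2)) ∉ S))}; let P : unitInterval → Literature.Probability.RandomPlanarGeometry.ConformalRectangle → ℝ → ℝ := fun t R δ => (Literature.Probability.LatticeModels.prodBernoulli (prm t)).real {S | cfg S ∈ Literature.Probability.Percolation.embDomainCrossing Literature.Probability.LatticeModels.squareLatticeEmbedding.z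 R.carrier δ (R.arc 0) (R.arc 2)}; let CardyMod : unitInterval → ℂ → Prop := fun t α => ∀ (R R' : Literature.Probability.RandomPlanarGeometry.ConformalRectangle) (φ : Literature.Probability.RandomPlanarGeometry.ConformalEquiv UpperHalfPlane.upperHalfPlaneSet R.carrier) (x : Fin 4 → ℝ), R.carrier = Literature.Barriers.CriticalPhenomena.moduliShear α '' R'.carrier → (∀ i, R.pt i = Literature.Barriers.CriticalPhenomena.moduliShear α (R'.pt i)) → R.IsUniformizing φ x → Filter.Tendsto (P t R') (nhdsWithin 0 (Set.Ioi 0)) (nhds (Literature.Probability.RandomPlanarGeometry.cardyFunction (Literature.Probability.RandomPlanarGeometry.crossRatio x))); let G : Set unitInterval := {t | ∃ α : ℂ, 0 < α.im ∧ CardyMod t α}; ∃ ε > 0, ∀ t : unitInterval, (t : ℝ) < ε → t ∈ G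

/-- child 2 (r1 split of SegmentOpen) -/
def GermPropagation : Prop :=
  let prm : unitInterval → Literature.Probability.LatticeModels.Site 2 × Fin 2 → unitInterval := fun t i => if i.2 = 0 then Literature.Probability.Percolation.half else Literature.Probability.Percolation.half * t; let cfg : Set (Literature.Probability.LatticeModels.Site 2 × Fin 2) → Literature.Probability.Percolation.BondConfig (Literature.Probability.LatticeModels.Site 2) := fun S => {e | ∃ v : Literature.Probability.LatticeModels.Site 2, (e = s(v, v + ![1, 0]) ∧ (v, (0 : Fin 2)) ∈ S) ∨ (e = s(v, v + ![0, 1]) ∧ ((v, (0 : Fin 2)) ∈ S ↔ (v, (1 : Fin 2)) ∉ S))}; let P : unitInterval → Literature.Probability.RandomPlanarGeometry.ConformalRectangle → ℝ → ℝ := fun t R δ => (Literature.Probability.LatticeModels.prodBernoulli (prm t)).real {S | cfg S ∈ Literature.Probability.Percolation.embDomainCrossing Literature.Probability.LatticeModels.squareLatticeEmbedding.z R.carrier δ (R.arc 0) (R.arc 2)}; let CardyMod : unitInterval → ℂ → Prop := fun t α => ∀ (R R' : Literature.Probability.RandomPlanarGeometry.ConformalRectangle) (φ : Literature.Probability.RandomPlanarGeometry.ConformalEquiv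 UpperHalfPlane.upperHalfPlaneSet R.carrier) (x : Fin 4 → ℝ), R.carrier = Literature.Barriers.CriticalPhenomena.moduliShear α '' R'.carrier → (∀ i, R.pt i = Literature.Barriers.CriticalPhenomena.moduliShear α (R'.pt i)) → R.IsUniformizing φ x → Filter.Tendsto (P t R') (nhdsWithin 0 (Set.Ioi 0)) (nhds (Literature.Probability.RandomPlanarGeometry.cardyFunction (Literature.Probability.RandomPlanarGeometry.crossRatio x))); let G : Set unitInterval := {t | ∃ α : ℂ, 0 < α.im ∧ CardyMod t α}; (∃ ε > 0, ∀ t : unitInterval, (t : ℝ) < ε → t ∈ G) → (∀ (t₀ : unitInterval) (R : Literature.Probability.RandomPlanarGeometry.ConformalRectangle) (ε : ℝ), 0 < ε → ∃ η > 0, ∀ t : unitInterval, dist t t₀ < η → ∀ δ : ℝ, 0 < δ → |P t R δ - P t₀ R δ| < ε) → IsOpen G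

end Summit.CriticalPhenomena.CardyFormulaZ2.Theses.CardySelfDualSegment

-- BC7 deterministic crux probes of the two children of the r1 split (summit := the sub Statement decl).
#h21_crux_probe Summit.CriticalPhenomena.CardyFormulaZ2.Theses.CardySelfDualSegment.NearSmirnov summit := CardyFormulaZ2
#h21_crux_probe Summit.CriticalPhenomena.CardyFormulaZ2.Theses.CardySelfDualSegment.GermPropagation summit := CardyFormulaZ2
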